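import Literature.Analysis.FluidPDE.OnsagerBDSVTransportEstimates
import Literature.Analysis.FluidPDE.OnsagerBDSVBiotSavart
import HarnessLib

/-!
# The BDSV perturbation: the backward flows are volume preserving (`det ∇Φ_i = 1`)

Buckmaster–De Lellis–Székelyhidi–Vicol (BDSV), *Onsager's conjecture for admissible weak
solutions*, CPAM 72 (2019) = arXiv:1701.08678, §5.2–5.3: the backward flows `Φ_i` of the
divergence-free glued velocity `v̄_q` (`(∂ₜ + v̄_q·∇)Φ_i = 0`, `Φ_i(·, t_i) = id`) are volume
preserving, `det ∇Φ_i ≡ 1`. The paper uses this tacitly in §5.3, where the cofactor matrix of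
`∇Φ_iᵀ` is identified with `∇Φ_i⁻¹` ("`curl(∇Φᵀ U(Φ)) = cof ∇Φᵀ (curl U)(Φ) = ∇Φ⁻¹ (curl U)(Φ)`",
the identity behind the curl form (5.28) of the perturbation), and in §6.1.3, where
`∇Φ_i⁻¹ R̃_{q,i} ∇Φ_i⁻ᵀ = R_{q,i}/ρ_{q,i}`. For the tree's rendering of `w_o` with the adjugate
(`BDSV.principalPart`) it is the bridge `adj ∇Φ_i = ∇Φ_i⁻¹`.

This file PROVES it (Liouville's theorem along characteristics):

* `BDSV.hasFDerivAt_det` — Jacobi's formula for `3 × 3` matrices, `D det(A)[B] = tr(adj A · B)`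
  (from the explicit expansions `Matrix.det_fin_three`, `Matrix.adjugate_fin_three`);
* `BDSV.advectiveDeriv_comp` — the chain rule `(∂ₜ + v·∇)(φ ∘ M) = Dφ(M)[(∂ₜ + v·∇)M]` for the
  transport derivative of `OnsagerBDSVTransportEstimates.lean`, its linear case, and the
  invariance under adding constants;
* `BDSV.advectiveDeriv_det_jacobian` — for a displacement `D` transported by `v`
  (`(∂ₜ + v·∇)D = -v`), the matrix `G = Id + ∇D` satisfies `(∂ₜ + v·∇)G = -G ∇v`
  (`BDSV.advectiveDeriv_gradField_eq`), hence `(∂ₜ + v·∇) det G = -det G · div v`;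
* `BDSV.det_one_add_jacobian_eq_one` — if moreover `div v = 0` and `D(t₀, ·) = 0`, then
  `det G ≡ 1` on `[0,T] × T³` (`det G - 1` is transported with zero datum; uniqueness by the
  Grönwall bound `BDSV.norm_le_gronwallBound_of_advectiveDeriv` along characteristics);
* `BDSV.FlowDisplacement.det_gradPhi_eq_one`, `BDSV.PerturbationData.det_gradPhi_eq_one` — the
  statement for the backward flows of §5.2 (`BDSV.FlowDisplacement`; the matrix `BDSV.gradPhi`
  of `OnsagerBDSVPerturbation.lean`) of a divergence-free velocity, in particular under the
  standing hypotheses of the perturbation step (`BDSV.PerturbationHypotheses`).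

## References

* T. Buckmaster, C. De Lellis, L. Székelyhidi Jr., V. Vicol, *Onsager's conjecture for admissible
  weak solutions*, Comm. Pure Appl. Math. 72 (2019) 229–274 = arXiv:1701.08678, §5.2 (backward
  flows), §5.3 (the identity `cof ∇Φᵀ = ∇Φ⁻¹` before (5.28)), §6.1.3, App. B.
-/

open Set
open scoped ContDiff Matrix

noncomputable section

namespace Literature.Analysis.FluidPDE

namespace BDSV

open FunctionSpaces FunctionSpaces.Torus

/-! ## Jacobi's formula for `3 × 3` determinants -/

section Jacobi

/-- **Jacobi's formula** for real `3 × 3` matrices, on the coordinate space `Fin 3 → Fin 3 → ℝ`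
of their entries: `M ↦ det M` is differentiable with `D det(A)[B] = tr(adj(A) B)` (both sides
are the explicit polynomials `Matrix.det_fin_three`, `Matrix.adjugate_fin_three`). [folklore] -/
theorem hasFDerivAt_det (A : Fin 3 → Fin 3 → ℝ) :
    HasFDerivAt (fun M : Fin 3 → Fin 3 → ℝ => (Matrix.of M).det)
      (LinearMap.toContinuousLinearMap
        ((Matrix.traceLinearMap (Fin 3) ℝ ℝ).comp ((LinearMap.mulLeft ℝ (Matrix.of A).adjugate).comp
          (Matrix.ofLinearEquiv ℝ :
            (Fin 3 → Fin 3 → ℝ) ≃ₗ[ℝ] Matrix (Fin 3) (Fin 3) ℝ).toLinearMap)))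
      A := by
  have hc : ∀ i j : Fin 3, HasFDerivAt (fun M : Fin 3 → Fin 3 → ℝ => M i j)
      (matrixEntry i j) A := fun i j => (matrixEntry i j).hasFDerivAt
  have hpoly := (((((((hc 0 0).mul (hc 1 1)).mul (hc 2 2)).sub (((hc 0 0).mul (hc 1 2)).mul
    (hc 2 1))).sub (((hc 0 1).mul (hc 1 0)).mul (hc 2 2))).add (((hc 0 1).mul (hc 1 2)).mul
    (hc 2 0))).add (((hc 0 2).mul (hc 1 0)).mul (hc 2 1))).sub
    (((hc 0 2).mul (hc 1 1)).mul (hc 2 0))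
  have heq : (fun M : Fin 3 → Fin 3 → ℝ => (Matrix.of M).det) = fun M =>
      M 0 0 * M 1 1 * M 2 2 - M 0 0 * M 1 2 * M 2 1 - M 0 1 * M 1 0 * M 2 2 +
        M 0 1 * M 1 2 * M 2 0 + M 0 2 * M 1 0 * M 2 1 - M 0 2 * M 1 1 * M 2 0 := by
    funext M
    rw [Matrix.det_fin_three]
    simp only [Matrix.of_apply]
  rw [heq]
  refine hpoly.congr_fderiv ?_
  ext B
  simp [Matrix.trace_fin_three, Matrix.adjugate_fin_three]
  simp only [Matrix.vecHead, Matrix.vecTail, Function.comp_apply, Fin.succ_zero_eq_one,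
    Fin.succ_one_eq_two]
  ring

/-- The determinant is a smooth function of the entries (a polynomial). [folklore] -/
theorem contDiff_det : ContDiff ℝ ∞ fun M : Fin 3 → Fin 3 → ℝ => (Matrix.of M).det := by
  have hc : ∀ i j : Fin 3, ContDiff ℝ ∞ fun M : Fin 3 → Fin 3 → ℝ => M i j :=
    fun i j => (matrixEntry i j).contDiff
  have heq : (fun M : Fin 3 → Fin 3 → ℝ => (Matrix.of M).det) = fun M =>
      M 0 0 * M 1 1 * M 2 2 - M 0 0 * M 1 2 * M 2 1 - M 0 1 * M 1 0 * M 2 2 +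
        M 0 1 * M 1 2 * M 2 0 + M 0 2 * M 1 0 * M 2 1 - M 0 2 * M 1 1 * M 2 0 := by
    funext M
    rw [Matrix.det_fin_three]
    simp only [Matrix.of_apply]
  rw [heq]
  exact (((((((hc 0 0).mul (hc 1 1)).mul (hc 2 2)).sub (((hc 0 0).mul (hc 1 2)).mul
    (hc 2 1))).sub (((hc 0 1).mul (hc 1 0)).mul (hc 2 2))).add (((hc 0 1).mul (hc 1 2)).mul
    (hc 2 0))).add (((hc 0 2).mul (hc 1 0)).mul (hc 2 1))).sub
    (((hc 0 2).mul (hc 1 1)).mul (hc 2 0))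

end Jacobi

/-! ## Chain rules for the transport derivative -/

section Chain

variable {E E' : Type*} [NormedAddCommGroup E] [NormedSpace ℝ E] [NormedAddCommGroup E']
  [NormedSpace ℝ E'] {T : ℝ} {v : ℝ → UnitAddTorus (Fin 3) → EuclideanSpace ℝ (Fin 3)}

/-- **Chain rule for the transport derivative**: for a jointly smooth field `M` on
`[0,T] × T³` and a map `φ` with derivative `φ'`, `(∂ₜ + v·∇)(φ ∘ M) = φ'(M)[(∂ₜ + v·∇)M]`
pointwise on `[0,T]`. [folklore] -/
theorem advectiveDeriv_comp (hT : 0 < T) {M : ℝ → UnitAddTorus (Fin 3) → E}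
    (hM : IsSmoothSpaceTimeOn (Icc 0 T) M) {φ : E → E'} {φ' : E → E →L[ℝ] E'}
    (hφ : ∀ e, HasFDerivAt φ (φ' e) e) {t : ℝ} (ht : t ∈ Icc 0 T) (x : UnitAddTorus (Fin 3)) :
    advectiveDeriv T v (fun s y => φ (M s y)) t x = φ' (M t x) (advectiveDeriv T v M t x) := by
  rw [advectiveDeriv_apply, advectiveDeriv_apply, map_add]
  congr 1
  · unfold timeDerivWithin
    exact ((hφ (M t x)).comp_hasDerivWithinAt t (hM.hasDerivWithinAt_slice ht x)).derivWithin
      (uniqueDiffOn_Icc hT t ht)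
  · unfold Torus.fderiv
    have h : liftAt (fun y => φ (M t y)) x = φ ∘ liftAt (M t) x := rfl
    have hd : DifferentiableAt ℝ (liftAt (M t) x) 0 :=
      (((hM.isSmooth_slice ht).liftAt x).differentiable (by simp)).differentiableAt
    rw [h, fderiv_comp 0 (hφ _).differentiableAt hd, (hφ _).fderiv, liftAt_apply_zero]
    rfl

/-- The transport derivative commutes with continuous linear maps:
`(∂ₜ + v·∇)(L ∘ M) = L ∘ (∂ₜ + v·∇)M`. [folklore] -/
theorem advectiveDeriv_clm_apply (hT : 0 < T) {M : ℝ → UnitAddTorus (Fin 3) → E}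
    (hM : IsSmoothSpaceTimeOn (Icc 0 T) M) (L : E →L[ℝ] E') {t : ℝ} (ht : t ∈ Icc 0 T)
    (x : UnitAddTorus (Fin 3)) :
    advectiveDeriv T v (fun s y => L (M s y)) t x = L (advectiveDeriv T v M t x) :=
  advectiveDeriv_comp hT hM (fun e => L.hasFDerivAt (x := e)) ht x

omit [NormedAddCommGroup E'] [NormedSpace ℝ E'] in
/-- Adding a constant does not change the transport derivative. [folklore] -/
theorem advectiveDeriv_const_add (c : E) (M : ℝ → UnitAddTorus (Fin 3) → E) (t : ℝ)
    (x : UnitAddTorus (Fin 3)) :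
    advectiveDeriv T v (fun s y => c + M s y) t x = advectiveDeriv T v M t x := by
  rw [advectiveDeriv_apply, advectiveDeriv_apply]
  congr 1
  · unfold timeDerivWithin
    exact derivWithin_const_add c
  · unfold Torus.fderiv
    have h : liftAt (fun y => c + M t y) x = fun w => c + liftAt (M t) x w := rfl
    rw [h, fderiv_const_add]

end Chain

/-! ## Liouville: `(∂ₜ + v·∇) det(Id + ∇D) = -det(Id + ∇D) div v`, hence `det ∇Φ = 1` -/

section Liouville

variable {T : ℝ} {v D : ℝ → UnitAddTorus (Fin 3) → EuclideanSpace ℝ (Fin 3)}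

/-- The entries `δ_{ab} + (D(D(t))(x) e_b)_a` of the deformation matrix `Id + ∇D` of
`Φ = id + D` form a jointly smooth field of coordinates, for jointly smooth `D`. [folklore] -/
theorem isSmoothSpaceTimeOn_jacobianEntries (hT : 0 < T) (hD : IsSmoothSpaceTimeOn (Icc 0 T) D) :
    IsSmoothSpaceTimeOn (Icc 0 T) (fun t x => fun a b : Fin 3 =>
      (if a = b then (1 : ℝ) else 0) + (gradField D t x (EuclideanSpace.single b 1)) a) := by
  have hG := hD.gradField (uniqueDiffOn_Icc hT)
  have hE : ∀ a b : Fin 3, IsSmoothSpaceTimeOn (Icc 0 T)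
      (fun t x => (if a = b then (1 : ℝ) else 0) +
        (gradField D t x (EuclideanSpace.single b 1)) a) := fun a b =>
    (isSmoothSpaceTimeOn_const (isSmooth_const _) _).add
      ((hG.clm_comp (ContinuousLinearMap.apply ℝ (EuclideanSpace ℝ (Fin 3))
        (EuclideanSpace.single b 1))).apply a)
  exact contDiffOn_pi' fun a => contDiffOn_pi' fun b => hE a b

/-- The deformation matrix `Id + ∇D` from its entries. [folklore] -/
theorem of_jacobianEntries (t : ℝ) (x : UnitAddTorus (Fin 3)) :
    (Matrix.of fun a b : Fin 3 =>
      (if a = b then (1 : ℝ) else 0) + (gradField D t x (EuclideanSpace.single b 1)) a) =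
      (1 : Matrix (Fin 3) (Fin 3) ℝ) +
        Matrix.of fun a b : Fin 3 => (gradField D t x (EuclideanSpace.single b 1)) a := by
  ext a b
  simp only [Matrix.of_apply, Matrix.add_apply, Matrix.one_apply]

/-- Linearity of the spatial derivative in the direction, in coordinates:
`(∇D(t,x) w)_a = ∑_c w_c (∇D(t,x) e_c)_a`. [folklore] -/
theorem gradField_apply_coord (t : ℝ) (x : UnitAddTorus (Fin 3)) (w : EuclideanSpace ℝ (Fin 3))
    (a : Fin 3) :
    (gradField D t x w) a = ∑ c, w c * (gradField D t x (EuclideanSpace.single c 1)) a := by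
  conv_lhs => rw [← (EuclideanSpace.basisFun (Fin 3) ℝ).sum_repr w]
  rw [map_sum]
  simp only [map_smul, EuclideanSpace.basisFun_repr, EuclideanSpace.basisFun_apply,
    WithLp.ofLp_sum, WithLp.ofLp_smul, Finset.sum_apply, Pi.smul_apply, smul_eq_mul]

/-- The diagonal entries of the velocity gradient sum to the divergence:
`∑_a (∇v(x) e_a)_a = div v(x)` for `C¹` fields. [folklore] -/
theorem sum_fderiv_single_apply_eq_divergence {u : UnitAddTorus (Fin 3) → EuclideanSpace ℝ (Fin 3)}
    (hu : IsContDiff 1 u) (x : UnitAddTorus (Fin 3)) :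
    ∑ a, (Torus.fderiv u x (EuclideanSpace.single a 1)) a = divergence u x := by
  rw [divergence]
  refine Finset.sum_congr rfl fun a _ => ?_
  have hua : IsContDiff 1 (fun y => u y a) :=
    (EuclideanSpace.proj a : EuclideanSpace ℝ (Fin 3) →L[ℝ] ℝ).contDiff.comp hu
  have hcomp :=
    fderiv_clm_comp_slice hu (EuclideanSpace.proj a : EuclideanSpace ℝ (Fin 3) →L[ℝ] ℝ) x
  rw [show (fun y => (EuclideanSpace.proj a : EuclideanSpace ℝ (Fin 3) →L[ℝ] ℝ) (u y)) =
    (fun y => u y a) from rfl] at hcomp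
  rw [partialDeriv_eq_fderiv_apply hua, hcomp]
  rfl

/-- **The transport equation of `det(Id + ∇D)`**: if `(∂ₜ + v·∇)D = -v` on `[0,T] × T³`
(so that `G = Id + ∇D` satisfies `(∂ₜ + v·∇)G = -G ∇v`, `BDSV.advectiveDeriv_gradField_eq`),
then `(∂ₜ + v·∇) det G = -det G · div v` (Jacobi: `tr(adj G · (-G∇v)) = -det G · tr ∇v`).
[cite: BuckmasterEtAl2018, App. B (transport equations; Liouville's formula)] -/
theorem advectiveDeriv_det_jacobian (hT : 0 < T) (hv : IsSmoothSpaceTimeOn (Icc 0 T) v)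
    (hD : IsSmoothSpaceTimeOn (Icc 0 T) D)
    (htr : ∀ s ∈ Icc 0 T, ∀ x, advectiveDeriv T v D s x = -v s x) {t : ℝ} (ht : t ∈ Icc 0 T)
    (x : UnitAddTorus (Fin 3)) :
    advectiveDeriv T v (fun s y => ((1 : Matrix (Fin 3) (Fin 3) ℝ) +
      Matrix.of fun a b : Fin 3 => (gradField D s y (EuclideanSpace.single b 1)) a).det) t x =
      -(((1 : Matrix (Fin 3) (Fin 3) ℝ) +
          Matrix.of fun a b : Fin 3 => (gradField D t x (EuclideanSpace.single b 1)) a).det *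
        divergence (v t) x) := by
  -- abbreviations: the entries `E` of `∇D`, `Jf` of `Id + ∇D`, and the velocity gradient `W`
  set E : ℝ → UnitAddTorus (Fin 3) → (Fin 3 → Fin 3 → ℝ) := fun s y a b =>
    (gradField D s y (EuclideanSpace.single b 1)) a with hE
  set Jf : ℝ → UnitAddTorus (Fin 3) → (Fin 3 → Fin 3 → ℝ) := fun s y a b =>
    (if a = b then (1 : ℝ) else 0) + (gradField D s y (EuclideanSpace.single b 1)) a with hJf
  set W : Matrix (Fin 3) (Fin 3) ℝ :=
    Matrix.of fun a b => (gradField v t x (EuclideanSpace.single b 1)) a with hW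
  have hJsm : IsSmoothSpaceTimeOn (Icc 0 T) Jf := isSmoothSpaceTimeOn_jacobianEntries hT hD
  have hGfield := hD.gradField (uniqueDiffOn_Icc hT)
  have hofJ : ∀ s y, Matrix.of (Jf s y) = (1 : Matrix (Fin 3) (Fin 3) ℝ) + Matrix.of (E s y) :=
    fun s y => of_jacobianEntries s y
  -- Step 1: chain rule with Jacobi's formula
  have hfun : (fun s y => ((1 : Matrix (Fin 3) (Fin 3) ℝ) +
      Matrix.of fun a b : Fin 3 => (gradField D s y (EuclideanSpace.single b 1)) a).det) =
      fun s y => (Matrix.of (Jf s y)).det := by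
    funext s y
    rw [hofJ]
  rw [hfun, advectiveDeriv_comp hT hJsm (fun A => hasFDerivAt_det A) ht x, ← hofJ]
  -- Step 2: `(∂ₜ + v·∇)(Id + ∇D) = -(Id + ∇D) W`, entrywise
  have hadv := advectiveDeriv_gradField_eq hT hv hD htr ht x
  have h2 : Matrix.of (advectiveDeriv T v Jf t x) = -(Matrix.of (Jf t x) * W) := by
    rw [hofJ, Matrix.add_mul, Matrix.one_mul]
    ext a b
    set L : (EuclideanSpace ℝ (Fin 3) →L[ℝ] EuclideanSpace ℝ (Fin 3)) →L[ℝ] ℝ :=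
      (EuclideanSpace.proj a).comp (ContinuousLinearMap.apply ℝ (EuclideanSpace ℝ (Fin 3))
        (EuclideanSpace.single b 1)) with hL
    have hLapp : ∀ φ : EuclideanSpace ℝ (Fin 3) →L[ℝ] EuclideanSpace ℝ (Fin 3),
        L φ = (φ (EuclideanSpace.single b 1)) a := fun φ => rfl
    have e1 : advectiveDeriv T v Jf t x a b = advectiveDeriv T v (fun s y => Jf s y a b) t x := by
      have h := advectiveDeriv_clm_apply (v := v) hT hJsm (matrixEntry a b) ht x
      simpa only [matrixEntry_apply] using h.symm
    have e2 : (fun s y => Jf s y a b) =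
        fun s y => (if a = b then (1 : ℝ) else 0) + L (gradField D s y) := by
      funext s y
      simp only [hJf, hLapp]
    rw [Matrix.of_apply, e1, e2, advectiveDeriv_const_add,
      advectiveDeriv_clm_apply (v := v) hT hGfield L ht x, hadv, hLapp, Matrix.neg_apply,
      Matrix.add_apply, Matrix.mul_apply]
    change -(gradField v t x (EuclideanSpace.single b 1)) a -
        (gradField D t x (gradField v t x (EuclideanSpace.single b 1))) a = _
    rw [gradField_apply_coord (D := D) t x (gradField v t x (EuclideanSpace.single b 1)) a]
    simp only [hE, hW, Matrix.of_apply, Fin.sum_univ_three]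
    ring
  -- Step 3: `tr(adj G · (-(G W))) = -det G · tr W = -det G · div v`
  have h1v : IsContDiff 1 (v t) := (hv.isSmooth_slice ht).isContDiff (by simp)
  have htrW : Matrix.trace W = divergence (v t) x := by
    rw [← sum_fderiv_single_apply_eq_divergence h1v x, Matrix.trace]
    simp only [Matrix.diag_apply, hW, Matrix.of_apply, gradField_apply]
  show Matrix.trace ((Matrix.of (Jf t x)).adjugate * Matrix.of (advectiveDeriv T v Jf t x)) = _
  rw [h2, Matrix.mul_neg, Matrix.trace_neg, ← Matrix.mul_assoc, Matrix.adjugate_mul,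
    Matrix.smul_mul,
    Matrix.one_mul, Matrix.trace_smul, smul_eq_mul, htrW, hofJ]

/-- **Liouville's theorem for transported displacements**: if `(∂ₜ + v·∇)D = -v` on
`[0,T] × T³` with `div v = 0` and `D(t₀, ·) = 0` for some `t₀ ∈ [0,T]`, then
`det(Id + ∇D) ≡ 1` on `[0,T] × T³` — the flow `Φ = id + D` is volume preserving. Proof:
`F = det(Id + ∇D) - 1` solves `(∂ₜ + v·∇)F = 0` with `F(t₀) = 0`, so `F ≡ 0` by the Grönwall
bound along characteristics. [folklore] -/
theorem det_one_add_jacobian_eq_one (hT : 0 < T) (hv : IsSmoothSpaceTimeOn (Icc 0 T) v)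
    (hD : IsSmoothSpaceTimeOn (Icc 0 T) D)
    (htr : ∀ s ∈ Icc 0 T, ∀ x, advectiveDeriv T v D s x = -v s x)
    (hdiv : ∀ s ∈ Icc 0 T, IsDivFree (v s)) {t₀ : ℝ} (ht₀ : t₀ ∈ Icc 0 T)
    (h0 : ∀ x, D t₀ x = 0) {t : ℝ} (ht : t ∈ Icc 0 T) (x : UnitAddTorus (Fin 3)) :
    ((1 : Matrix (Fin 3) (Fin 3) ℝ) +
      Matrix.of fun a b : Fin 3 => (gradField D t x (EuclideanSpace.single b 1)) a).det = 1 := by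
  set Jf : ℝ → UnitAddTorus (Fin 3) → (Fin 3 → Fin 3 → ℝ) := fun s y a b =>
    (if a = b then (1 : ℝ) else 0) + (gradField D s y (EuclideanSpace.single b 1)) a with hJf
  have hJsm : IsSmoothSpaceTimeOn (Icc 0 T) Jf := isSmoothSpaceTimeOn_jacobianEntries hT hD
  have hofJ : ∀ s y, Matrix.of (Jf s y) = (1 : Matrix (Fin 3) (Fin 3) ℝ) +
      Matrix.of fun a b : Fin 3 => (gradField D s y (EuclideanSpace.single b 1)) a :=
    fun s y => of_jacobianEntries s y
  set F : ℝ → UnitAddTorus (Fin 3) → ℝ := fun s y => (Matrix.of (Jf s y)).det - 1 with hF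
  have hFsm : IsSmoothSpaceTimeOn (Icc 0 T) F := by
    show ContDiffOn ℝ ∞ ((fun M : Fin 3 → Fin 3 → ℝ => (Matrix.of M).det - 1) ∘ stLift Jf) _
    exact (contDiff_det.sub contDiff_const).comp_contDiffOn hJsm
  -- `(∂ₜ + v·∇)F = 0`
  have hFadv : ∀ s ∈ Icc 0 T, ∀ y, advectiveDeriv T v F s y = 0 := by
    intro s hs y
    have hc1 := advectiveDeriv_comp (v := v) hT hJsm (fun A => (hasFDerivAt_det A).sub_const 1) hs y
    have hc2 := advectiveDeriv_comp (v := v) hT hJsm (fun A => hasFDerivAt_det A) hs y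
    have hdet := advectiveDeriv_det_jacobian hT hv hD htr hs y
    have hfun : (fun s' y' => (Matrix.of (Jf s' y')).det) =
        fun s' y' => ((1 : Matrix (Fin 3) (Fin 3) ℝ) +
          Matrix.of fun a b : Fin 3 => (gradField D s' y' (EuclideanSpace.single b 1)) a).det := by
      funext s' y'
      rw [hofJ]
    have hdiv0 : divergence (v s) y = 0 := hdiv s hs y
    calc advectiveDeriv T v F s y
        = advectiveDeriv T v (fun s' y' => (Matrix.of (Jf s' y')).det) s y := by rw [hF, hc1, hc2]
      _ = 0 := by rw [hfun, hdet, hdiv0, mul_zero, neg_zero]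
  -- `F(t₀) = 0`
  have hF0 : ∀ y, F t₀ y = 0 := by
    intro y
    have hD0 : D t₀ = fun _ => 0 := funext h0
    have hg : Torus.fderiv (D t₀) y = 0 := by rw [hD0, fderiv_const_slice]
    have hJ0 : Matrix.of (Jf t₀ y) = 1 := by
      ext a b
      simp [hJf, hg, Matrix.one_apply]
    simp only [hF, hJ0, Matrix.det_one, sub_self]
  -- Grönwall with zero data
  have hb : ∀ s ∈ uIcc t₀ t, ∀ y, ‖advectiveDeriv T v F s y‖ ≤ 0 * ‖F s y‖ + 0 := by
    intro s hs y
    rw [hFadv s (uIcc_subset_Icc ht₀ ht hs) y, norm_zero, zero_mul, add_zero]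
  have hG := norm_le_gronwallBound_of_advectiveDeriv hT hv hFsm ht₀ ht
    (fun y => by rw [hF0 y, norm_zero]) hb x
  simp only [gronwallBound_K0, zero_mul, add_zero, norm_le_zero_iff] at hG
  have h1 : (Matrix.of (Jf t x)).det - 1 = 0 := hG
  rw [hofJ] at h1
  linarith

/-- **The backward flows are volume preserving**: for a jointly smooth divergence-free velocity
field `v` on `[0,T] × T³` (`T > 0`) and a backward flow `Φ = id + D` anchored at `t₀ ∈ [0,T]`
(`BDSV.FlowDisplacement T v t₀`), `det ∇Φ(t, x) = det(Id + ∇D(t,x)) = 1` on `[0,T] × T³`.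
[cite: BuckmasterEtAl2018, §5.3 (cof ∇Φᵀ = ∇Φ⁻¹, before (5.28))] -/
theorem FlowDisplacement.det_gradPhi_eq_one (hT : 0 < T) (hv : IsSmoothSpaceTimeOn (Icc 0 T) v)
    (hdiv : ∀ s ∈ Icc 0 T, IsDivFree (v s)) {t₀ : ℝ} (ht₀ : t₀ ∈ Icc 0 T)
    (Φ : FlowDisplacement T v t₀) {t : ℝ} (ht : t ∈ Icc 0 T) (x : UnitAddTorus (Fin 3)) :
    ((1 : Matrix (Fin 3) (Fin 3) ℝ) + Matrix.of fun a b => partialDeriv b (Φ.D t) x a).det = 1 := by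
  have h := det_one_add_jacobian_eq_one hT hv Φ.smooth (fun s hs y => Φ.advectiveDeriv_eq hs y)
    hdiv ht₀ Φ.anchor ht x
  have hc : IsContDiff 1 (Φ.D t) := (Φ.smooth.isSmooth_slice ht).isContDiff (by simp)
  have hm : (Matrix.of fun a b => partialDeriv b (Φ.D t) x a) =
      Matrix.of fun a b : Fin 3 => (gradField Φ.D t x (EuclideanSpace.single b 1)) a := by
    ext a b
    simp only [Matrix.of_apply, gradField_apply, partialDeriv_eq_fderiv_apply hc]
  rw [hm]
  exact h

/-- **`det ∇Φ_i = 1` for the construction data of the perturbation step**: under the standing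
hypotheses (`v̄_q` divergence free, `T > 0`) and for `a ≥ 1` (so that the anchors
`min(t_i, T)`, `t_i = iτ_q ≥ 0`, lie in `[0,T]`), the deformation matrices `BDSV.gradPhi` of the
backward flows of any `BDSV.PerturbationData` have unit determinant on `[0,T] × T³`.
[cite: BuckmasterEtAl2018, §5.3 (cof ∇Φᵀ = ∇Φ⁻¹, before (5.28))] -/
theorem PerturbationData.det_gradPhi_eq_one {P : Params} {S : Setting} {Nbar : ℕ}
    {Cin C₀ c₀ : ℝ} {Cη : ℕ → ℕ → ℝ} (H : PerturbationHypotheses P S Nbar Cin C₀)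
    (𝒟 : PerturbationData P S c₀ Cη) (ha : 1 ≤ P.a) (i : ℕ) {t : ℝ} (ht : t ∈ Icc 0 S.T)
    (x : UnitAddTorus (Fin 3)) : (gradPhi 𝒟.D i t x).det = 1 := by
  have hτ : 0 < P.τ S.q := glueScale_pos ha S.q
  have hanchor : min ((i : ℝ) * P.τ S.q) S.T ∈ Icc 0 S.T :=
    ⟨le_min (mul_nonneg i.cast_nonneg hτ.le) H.pos_T.le, min_le_right _ _⟩
  exact (𝒟.flow i).det_gradPhi_eq_one H.pos_T H.eulerReynolds.smooth_velocity
    H.eulerReynolds.divFree hanchor ht x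

end Liouville

end BDSV

end Literature.Analysis.FluidPDE
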